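import Summits.BirchSwinnertonDyer.Rank1Residual.X5.TwoAdicTargets
import Literature.NumberTheory.EllipticCurves.TwoAdicImageSurjectivity
import HarnessLib

/-!
# Class O1 (X5, `p = 2`, non-CM): the habitat binder `TwoAdicSurjective W` from PRINT
# (Dokchitser–Dokchitser 2012 + the mod-`8` lift) — item (21) of the o1 lead's typer queue v3.2

HONEST FRAMING (cell `b2b-bsdres`, run/shared/lean/b2b/bsd-rank1-residual/, verbatim in every
file): the goal of the cell is to DELETE the COMBINATION-SHAPED residual classes of the
Birch–Swinnerton-Dyer formula for ALL analytic-rank `≤ 1` elliptic curves over `ℚ` — "full BSD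
formula for every rank `≤ 1` curve in class `C`" assembled STRICTLY from published theorems — so
that the rank-`≤ 1` remainder becomes exactly the CONSTRUCTION-SHAPED classes, which are TYPED
(missing-input `Prop`s), NOT attempted. This is not "finishing BSD". Research routes; no claim
beyond stated classes; census output = EVIDENCE, never a Literature fact; nothing here is booked;
no mark of RESIDUAL-MAP §I moves.

Unit `b2b-bsdres-cc-typer-4` (lane CLASS-CLOSURE, class O1), gen 4. Theorems only (glue); 0 typed
targets, 0 named facts here. The two named facts live in
`Literature/NumberTheory/EllipticCurves/TwoAdicImageSurjectivity.lean`: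
`DokchitserDokchitser2012_surjective_mod_two_four_eight` (Math. Z. 272 (2012), Theorem) and
`hasSurjectiveModNGaloisRep_two_pow_of_eight` (Rouse–Zureick-Brown 2015 §3 Lemma / §1). With them
the habitat binder of R1 / B3 / L3-14 (`TwoAdicSurjective W`, `X5/TwoAdicTargets.lean`) is
discharged per curve from: no rational point of order `2`, `Δ, −Δ, 2Δ, −2Δ ∉ ℚ^{×2}`,
`j ∉ {−4t³(t + 8) : t ∈ ℚ}` — the Dokchitser–Dokchitser test the censuses already compute (lens-4
ANATOMY2-v1 `img2_level`, typer `surj8`; D22: 4 382 / 4 382 agreement, EVIDENCE).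

* `twoAdicSurjective_of_surjModEight` — `SurjModEight W → TwoAdicSurjective W` given the lift fact
  (the implication announced, not vendored, in `X5/TwoAdicTargets.lean`).
* `surjModEight_of_dokchitser`, **`twoAdicSurjective_of_dokchitser`** — the per-curve discharge shape.
References: [DokchitserDokchitserMathZ2012] Theorem; [RouseZureickbrown2015] §1, §3.
-/

set_option autoImplicit false

noncomputable section

open scoped Classical

open WeierstrassCurve Literature.NumberTheory.EllipticCurves

namespace Summit.BirchSwinnertonDyer.Rank1Residual.X5.O1

variable (W : WeierstrassCurve ℚ) [W.IsElliptic] [W.IsGloballyMinimal]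

omit [W.IsGloballyMinimal] in
/-- **`ρ̄_{E,8}` onto ⟹ `ρ_{E,2^∞}` onto** (PROVED modulo the named lift fact
`hasSurjectiveModNGaloisRep_two_pow_of_eight`): `SurjModEight W → TwoAdicSurjective W`.
[cite: RouseZureickbrown2015, §3 Lemma and §1] [cite: DokchitserDokchitserMathZ2012, Introduction] -/
theorem twoAdicSurjective_of_surjModEight (hlift : hasSurjectiveModNGaloisRep_two_pow_of_eight)
    (h8 : SurjModEight W) : TwoAdicSurjective W :=
  fun n _ => hlift W h8 n

omit [W.IsGloballyMinimal] in
/-- **The Dokchitser–Dokchitser test for `ρ̄_{E,8}`** (PROVED modulo the named fact): no rational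
point of order `2`, `Δ, −Δ, 2Δ, −2Δ` non-squares, `j ≠ −4t³(t + 8)` ⟹ `SurjModEight W`.
[cite: DokchitserDokchitserMathZ2012, Theorem (p. 961)] -/
theorem surjModEight_of_dokchitser (hDD : DokchitserDokchitser2012_surjective_mod_two_four_eight)
    (h2 : ∀ P : W.toAffine.Point, 2 • P = 0 → P = 0) (hΔ : ¬ IsSquare W.Δ)
    (hΔ₁ : ¬ IsSquare (-W.Δ)) (hΔ₂ : ¬ IsSquare (2 * W.Δ)) (hΔ₃ : ¬ IsSquare (-2 * W.Δ))
    (hj : ∀ t : ℚ, W.j ≠ -4 * t ^ 3 * (t + 8)) : SurjModEight W := by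
  obtain ⟨h₂, h₄, h₈⟩ := hDD W
  exact h₈.mpr ⟨h₄.mpr ⟨h₂.mpr ⟨h2, hΔ⟩, hΔ₁, hj⟩, hΔ₂, hΔ₃⟩

omit [W.IsGloballyMinimal] in
/-- **The habitat binder from PRINT, per curve (PROVED modulo the two named facts):**
no rational point of order `2`, `Δ, −Δ, 2Δ, −2Δ ∉ ℚ^{×2}`, `j ≠ −4t³(t + 8)` for all `t ∈ ℚ` ⟹
`TwoAdicSurjective W`. The hypotheses are decidable data per curve (the censuses' Dokchitser–Dokchitser
bit); a records module discharges them by certificate. [cite: DokchitserDokchitserMathZ2012, Theorem (p. 961)]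
[cite: RouseZureickbrown2015, §3 Lemma and §1] -/
theorem twoAdicSurjective_of_dokchitser (hDD : DokchitserDokchitser2012_surjective_mod_two_four_eight)
    (hlift : hasSurjectiveModNGaloisRep_two_pow_of_eight)
    (h2 : ∀ P : W.toAffine.Point, 2 • P = 0 → P = 0) (hΔ : ¬ IsSquare W.Δ)
    (hΔ₁ : ¬ IsSquare (-W.Δ)) (hΔ₂ : ¬ IsSquare (2 * W.Δ)) (hΔ₃ : ¬ IsSquare (-2 * W.Δ))
    (hj : ∀ t : ℚ, W.j ≠ -4 * t ^ 3 * (t + 8)) : TwoAdicSurjective W :=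
  fun n _ => hasSurjectiveModNGaloisRep_two_pow_of_criteria hDD hlift W h2 hΔ hΔ₁ hΔ₂ hΔ₃ hj n

end Summit.BirchSwinnertonDyer.Rank1Residual.X5.O1

end
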